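import Summits.CriticalPhenomena.PercolationContinuityZ3.Theorems.PercNearOneGluingNoHeavyLowerTailAntiBandModP

/-!
# `NoHeavyLowerTail` (crux stmt-CriticalPhenomena-4575), lane prim-ineq-gen-4 (gen 25): explicit ground-set-size lists for (AB_6) and (AB_7)

Support file (`--supports stmt-CriticalPhenomena-4575`; memo `run/shared/lean/prim/prim-ineq-gen-4/FINDING-MODP-NONSINGULARITY-g25.md` §2).  No definitions, no `sorry`.
Instances of `AntiBandModP.antiBand_of_not_dvd_lcm`: (AB_l) holds on `β` unless `|β| − 2l + 1` divides `lcm(1,…,l−1) = 60` (l = 6, 7), i.e. outside twelve explicit sizes.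
-/

namespace Summit.CriticalPhenomena.PercolationContinuityZ3.Theorems.AntiBandModPCells

open Finset
open scoped FinsetFamily

variable {β : Type*} [DecidableEq β] [Fintype β]

/-- **(AB_6) on every ground set except twelve sizes.**  If `12 ≤ |β|` and `|β| ∉ {12,13,14,15,16,17,21,23,26,31,41,71}` then (AB_6) holds for all upper sets `A, V`
on `β` (KERNEL; the excluded sizes are `11 + d`, `d ∣ 60 = lcm(1..5)`; all of them except `|β| = 12` are covered by the g22 frame certificates, not formalised).
[`AntiBandModP.antiBand_of_not_dvd_lcm` with `l = 6`] -/
theorem antiBand_six (A V : Finset (Finset β)) (hA : IsUpperSet (A : Set (Finset β))) (hV : IsUpperSet (V : Set (Finset β)))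
    (hβ : 12 ≤ Fintype.card β) (hex : Fintype.card β ∉ ({12, 13, 14, 15, 16, 17, 21, 23, 26, 31, 41, 71} : Finset ℕ)) :
    #((A ∩ Vᶜˢ).filter fun s => #s < 6 ∨ #sᶜ < 6) ≤ #((A ∩ V).filter fun s => #s < 6 ∨ #sᶜ < 6) := by
  apply AntiBandModP.antiBand_of_not_dvd_lcm 6 (by norm_num) A V hA hV (by omega)
  intro hd
  have hl : (Finset.Icc 1 (6 - 1)).lcm id = 60 := by decide
  rw [hl] at hd
  have hmem : Fintype.card β - (2 * 6 - 1) ∈ Nat.divisors 60 := Nat.mem_divisors.2 ⟨hd, by norm_num⟩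
  have hdiv : Nat.divisors 60 = {1, 2, 3, 4, 5, 6, 10, 12, 15, 20, 30, 60} := by decide
  rw [hdiv] at hmem
  apply hex
  simp only [Finset.mem_insert, Finset.mem_singleton] at hmem ⊢
  omega

/-- **(AB_7) on every ground set except twelve sizes.**  If `14 ≤ |β|` and `|β| ∉ {14,15,16,17,18,19,23,25,28,33,43,73}` then (AB_7) holds for all upper sets `A, V`
on `β` (KERNEL; excluded sizes `13 + d`, `d ∣ 60 = lcm(1..6)`; of these, 23,25,28,33,43,73 are covered by the g23 frame certificates, and 14..19 are OPEN).
[`AntiBandModP.antiBand_of_not_dvd_lcm` with `l = 7`] -/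
theorem antiBand_seven (A V : Finset (Finset β)) (hA : IsUpperSet (A : Set (Finset β))) (hV : IsUpperSet (V : Set (Finset β)))
    (hβ : 14 ≤ Fintype.card β) (hex : Fintype.card β ∉ ({14, 15, 16, 17, 18, 19, 23, 25, 28, 33, 43, 73} : Finset ℕ)) :
    #((A ∩ Vᶜˢ).filter fun s => #s < 7 ∨ #sᶜ < 7) ≤ #((A ∩ V).filter fun s => #s < 7 ∨ #sᶜ < 7) := by
  apply AntiBandModP.antiBand_of_not_dvd_lcm 7 (by norm_num) A V hA hV (by omega)
  intro hd
  have hl : (Finset.Icc 1 (7 - 1)).lcm id = 60 := by decide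
  rw [hl] at hd
  have hmem : Fintype.card β - (2 * 7 - 1) ∈ Nat.divisors 60 := Nat.mem_divisors.2 ⟨hd, by norm_num⟩
  have hdiv : Nat.divisors 60 = {1, 2, 3, 4, 5, 6, 10, 12, 15, 20, 30, 60} := by decide
  rw [hdiv] at hmem
  apply hex
  simp only [Finset.mem_insert, Finset.mem_singleton] at hmem ⊢
  omega

end Summit.CriticalPhenomena.PercolationContinuityZ3.Theorems.AntiBandModPCells
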